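import Literature.Geometry.Kaehler.ComplexTorusCyclotomicAutomorphismMumfordTateTorus
import Literature.AlgebraicGeometry.ComplexMultiplication.MumfordTateTorusAbelianVarietyRankLowerBounds
import HarnessLib

/-!
# Hodge classes on all powers of a complex torus with an automorphism of characteristic polynomial `Φ_d`
# (primitive type, `φ(d) = 2ℓ` with `ℓ` prime, or `φ(d) ≤ 6`) are generated by divisor classes — in particular on
# all powers of the `ζ_5`-surface and of the `ζ_3`-curve

Layer `Literature/Geometry/Kaehler`, namespace `Literature.Geometry.Kaehler.ComplexTorus`; lane `lit-hodgefound`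
(Track 2 foundations library), Layer A2/A3 junction, row «A2-26(gf)» (self-proposed 2026-08-28, prover seat
`lit-hodgefound-p10`, generation 31, FILE 14).  The series FILES 1–13 puts a complex torus `X` with an endomorphism
`u`, `P_u = Φ_d`, of primitive type in the position the tree's Mumford–Tate machinery wants: `X` is an ABELIAN VARIETY
(FILE 1), SIMPLE (FILE 12), and `MT(X)(ℂ)` IS AN ALGEBRAIC TORUS (FILE 13).  The tree's structure-free forms of
YANAI's theorem (a simple abelian variety of CM type of PRIME dimension `ℓ` is nondegenerate, `rank MT = ℓ + 1`, hence
— Tankeev, Ribet — `Hdg(Xⁿ) = Div(Xⁿ)` for all `n`) and of MOONEN–ZARHIN (simple of CM type of dimension `≤ 3`) then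
give: **the Hodge classes of every degree on every power `X^k` are spanned by products of divisor classes** whenever
`φ(d) = 2ℓ` with `ℓ` prime (`d = 5, 7, 9, 11, 14, 18, 22, 23, …`) or `φ(d) ≤ 6`.  For `d = 5` every type is primitive
(FILE 10): EVERY `2`-dimensional complex torus with an endomorphism of order `5` satisfies the Hodge conjecture on
all its powers, with `rank MT = 3`; likewise every one-dimensional complex torus with an endomorphism of order `3`.

WHAT IS PROVED (theorems only; no `def`, no instance, no named fact; net debt 0; the standing instance hypothesis
`[HodgeTensorFacts]` of the tree's Hodge-structure tensor constructions is inherited from the cited tree theorems).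
* §1 **`divisorClasses_powPeriod_eq_hodgeClasses_of_iso_of_prime`**, `mtRank_hodgeStructure_eq_of_iso_of_prime`
  (`rank MT(X) = ℓ + 1`), **`divisorClasses_powPeriod_eq_hodgeClasses_of_iso_of_totient_le_six`**.
* §2 **`divisorClasses_powPeriod_eq_hodgeClasses_of_orderOf_eq_five`** (ALL POWERS OF A `2`-DIMENSIONAL COMPLEX TORUS
  WITH AN ENDOMORPHISM OF ORDER `5`), `mtRank_hodgeStructure_eq_three_of_orderOf_eq_five`.
* §3 **`divisorClasses_powPeriod_eq_hodgeClasses_of_orderOf_eq_three`** (all powers of a one-dimensional complex torus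
  with an endomorphism of order `3`).

Sources.  H. Yanai, *On the rank of CM-type*, Nagoya Math. J. 97 (1985), §4 Theorem (p. 171); B. B. Gordon, *A survey
of the Hodge conjecture for abelian varieties* (1999), Thm. 6.3 (2) and Remark (Tankeev, Ribet: `Hdg(Aⁿ) = Div(Aⁿ)`
for `A` simple of CM type of prime dimension); B. Moonen, Yu. Zarhin, *Hodge classes on abelian varieties of low
dimension*, Math. Ann. 315 (1999), Thm. 0.1 (4); all as vendored by the tree
(`Literature/AlgebraicGeometry/ComplexMultiplication/MumfordTateTorusAbelianVarietyRankLowerBounds.lean`).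
Ch. Birkenhake, H. Lange, *Complex Abelian Varieties*, 2nd ed. (2004), §13.3 (the tori with an automorphism of order
`d`, `φ(d) = 2g`) — not held (acq-10211), locator as cited by this lane's earlier rows.

## References

* [Yanai1985] H. Yanai, *On the rank of CM-type*, Nagoya Math. J. 97 (1985), §4 Theorem (p. 171).
* [Gordon1999HodgeAVSurvey] B. B. Gordon, *A survey of the Hodge conjecture for abelian varieties*, Appendix B in
  J. D. Lewis, *A Survey of the Hodge Conjecture*, 2nd ed., CRM Monograph Series 10, AMS (1999), Thm. 6.3 (2), Remark.
* [MoonenZarhin1999LowDim] B. Moonen, Yu. Zarhin, *Hodge classes on abelian varieties of low dimension*, Math. Ann.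
  315 (1999), Thm. 0.1 (4).
* [BirkenhakeLange2004] Ch. Birkenhake, H. Lange, *Complex Abelian Varieties*, 2nd ed., Grundlehren 302 (2004), §13.3.
-/

noncomputable section

open scoped Classical nonZeroDivisors NumberField Manifold ContDiff MatrixGroups
open NumberField Module Polynomial

namespace Literature.Geometry.Kaehler

namespace ComplexTorus

open Literature.AlgebraicGeometry.Motives (CMType HodgeTensorFacts)
open Literature.NumberTheory.ComplexMultiplication.CMTypeLattice (periodIso)

/-! ### §1 Primitive type, `φ(d) = 2ℓ` (`ℓ` prime) or `φ(d) ≤ 6`: `Hdg(X^k) = Div(X^k)` for all `k` -/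

section General

variable {ι : Type} [Fintype ι] [DecidableEq ι] {E : Type} [NormedAddCommGroup E] [NormedSpace ℂ E]
  {P : (ι → ℝ) ≃L[ℝ] E} {d : ℕ} [NeZero d] {K : Type} [Field K] [NumberField K]

omit [DecidableEq ι] in
/-- `ι` is nonempty when `P_A = Φ_d` (`#ι = φ(d) > 0`). [folklore] -/
private theorem nonempty_of_charpoly_eq_cyclotomic [DecidableEq ι] {A : Matrix ι ι ℤ}
    (hP : A.charpoly = cyclotomic d ℤ) : Nonempty ι := by
  rw [← Fintype.card_pos_iff, card_eq_totient_of_charpoly_eq_cyclotomic hP]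
  exact Nat.totient_pos.2 (NeZero.pos d)

/-- **`Hdg(X^k) = Div(X^k)` FOR ALL `k` — THE HODGE CLASSES ON EVERY POWER ARE GENERATED BY DIVISOR CLASSES** for a
complex torus `X` with an endomorphism `u`, `P_u = Φ_d`, `X ≅ ℂ^Φ/Φ(𝔞)` with the model simple (`Φ` primitive), and
`φ(d) = 2ℓ` with `ℓ` prime: `X` is a simple abelian variety of CM type of prime dimension `ℓ` (FILES 1, 12, 13), hence
nondegenerate (Yanai) and `Hdg = Div` on all powers (Tankeev, Ribet). [cite: Yanai1985, §4 Theorem (p. 171)]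
[cite: Gordon1999HodgeAVSurvey, Thm. 6.3 (2) and Remark] [cite: BirkenhakeLange2004, §13.3] -/
theorem divisorClasses_powPeriod_eq_hodgeClasses_of_iso_of_prime [HodgeTensorFacts.{0, 0}] {A : Matrix ι ι ℤ}
    (hA : A ∈ endRingInt P) (hP : A.charpoly = cyclotomic d ℤ) {Φ : CMType K} {I : (FractionalIdeal (𝓞 K)⁰ K)ˣ}
    (hS : ComplexTorus.IsSimple (periodIso Φ I)) (e : ComplexTorus P ≃+ ComplexTorus (periodIso Φ I))
    (he : ContMDiff 𝓘(ℂ, E) 𝓘(ℂ, Φ.1 → ℂ) ω e) (he₂ : ContMDiff 𝓘(ℂ, Φ.1 → ℂ) 𝓘(ℂ, E) ω e.symm) {ℓ : ℕ}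
    (hℓ : ℓ.Prime) (hcard : Nat.totient d = 2 * ℓ) (k p : ℕ) :
    divisorClasses (powPeriod P k) p = hodgeClasses (powPeriod P k) p := by
  haveI := nonempty_of_charpoly_eq_cyclotomic hP
  exact (isAbelianVariety_of_charpoly_eq_cyclotomic hA hP).divisorClasses_powPeriod_eq_hodgeClasses_of_isSimple_of_card_eq_two_mul_prime_of_isTorusSubgroup_mumfordTateGroupC
    (isSimple_of_iso hS e he he₂) (isTorusSubgroup_mumfordTateGroupC_of_iso hS e he he₂) hℓ
    (by rw [card_eq_totient_of_charpoly_eq_cyclotomic hP, hcard]) k p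

/-- **`rank MT(X) = ℓ + 1`** (Yanai: a simple abelian variety of CM type of prime dimension `ℓ` is nondegenerate) for
`X` as above with `φ(d) = 2ℓ`. [cite: Yanai1985, §4 Theorem (p. 171)] [cite: Gordon1999HodgeAVSurvey, Thm. 6.3 (2) and Remark] -/
theorem mtRank_hodgeStructure_eq_of_iso_of_prime [HodgeTensorFacts.{0, 0}] {A : Matrix ι ι ℤ}
    (hA : A ∈ endRingInt P) (hP : A.charpoly = cyclotomic d ℤ) {Φ : CMType K} {I : (FractionalIdeal (𝓞 K)⁰ K)ˣ}
    (hS : ComplexTorus.IsSimple (periodIso Φ I)) (e : ComplexTorus P ≃+ ComplexTorus (periodIso Φ I))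
    (he : ContMDiff 𝓘(ℂ, E) 𝓘(ℂ, Φ.1 → ℂ) ω e) (he₂ : ContMDiff 𝓘(ℂ, Φ.1 → ℂ) 𝓘(ℂ, E) ω e.symm) {ℓ : ℕ}
    (hℓ : ℓ.Prime) (hcard : Nat.totient d = 2 * ℓ) : (hodgeStructure P 1).mtRank = ℓ + 1 := by
  haveI := nonempty_of_charpoly_eq_cyclotomic hP
  exact (isAbelianVariety_of_charpoly_eq_cyclotomic hA hP).mtRank_eq_add_one_of_isSimple_of_card_eq_two_mul_prime_of_isTorusSubgroup_mumfordTateGroupC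
    (isSimple_of_iso hS e he he₂) (isTorusSubgroup_mumfordTateGroupC_of_iso hS e he he₂) hℓ
    (by rw [card_eq_totient_of_charpoly_eq_cyclotomic hP, hcard])

/-- **`Hdg(X^k) = Div(X^k)` for all `k`** for `X` with `P_u = Φ_d`, `X ≅ ℂ^Φ/Φ(𝔞)` with the model simple, and
`φ(d) ≤ 6` (`dim X ≤ 3`: Moonen–Zarhin, simple of CM type). [cite: MoonenZarhin1999LowDim, Thm. 0.1 (4)]
[cite: BirkenhakeLange2004, §13.3] -/
theorem divisorClasses_powPeriod_eq_hodgeClasses_of_iso_of_totient_le_six [HodgeTensorFacts.{0, 0}]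
    {A : Matrix ι ι ℤ} (hA : A ∈ endRingInt P) (hP : A.charpoly = cyclotomic d ℤ) {Φ : CMType K}
    {I : (FractionalIdeal (𝓞 K)⁰ K)ˣ} (hS : ComplexTorus.IsSimple (periodIso Φ I))
    (e : ComplexTorus P ≃+ ComplexTorus (periodIso Φ I)) (he : ContMDiff 𝓘(ℂ, E) 𝓘(ℂ, Φ.1 → ℂ) ω e)
    (he₂ : ContMDiff 𝓘(ℂ, Φ.1 → ℂ) 𝓘(ℂ, E) ω e.symm) (h6 : Nat.totient d ≤ 6) (k p : ℕ) :
    divisorClasses (powPeriod P k) p = hodgeClasses (powPeriod P k) p := by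
  haveI := nonempty_of_charpoly_eq_cyclotomic hP
  exact (isAbelianVariety_of_charpoly_eq_cyclotomic hA hP).divisorClasses_powPeriod_eq_hodgeClasses_of_isSimple_of_card_le_six_of_isTorusSubgroup_mumfordTateGroupC
    (isSimple_of_iso hS e he he₂) (isTorusSubgroup_mumfordTateGroupC_of_iso hS e he he₂)
    (by rw [card_eq_totient_of_charpoly_eq_cyclotomic hP]; exact h6) k p

end General

/-! ### §2 All powers of a `2`-dimensional complex torus with an endomorphism of order `5` -/

section Five

variable {ι : Type} [Fintype ι] [DecidableEq ι] {E : Type} [NormedAddCommGroup E] [NormedSpace ℂ E]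
  {P : (ι → ℝ) ≃L[ℝ] E}

set_option backward.isDefEq.respectTransparency false in -- Mathlib's instance
-- `IsCyclotomicExtension {5} ℚ (CyclotomicField 5 ℚ)` is keyed on `CyclotomicField.algebra`, the goal on
-- `DivisionRing.toRatAlgebra` (same workaround as FILE 1 `isAbelianVariety_of_charpoly_eq_cyclotomic`)
/-- **THE HODGE CLASSES ON EVERY POWER OF A `2`-DIMENSIONAL COMPLEX TORUS WITH AN ENDOMORPHISM OF ORDER `5` ARE
GENERATED BY DIVISOR CLASSES** (`X ≅ ℂ²/Φ(𝓞_{ℚ(ζ_5)})`, a simple CM abelian surface: `Hdg(X^k) = Div(X^k)` for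
all `k`). [cite: Gordon1999HodgeAVSurvey, Thm. 6.3 (2) and Remark] [cite: MoonenZarhin1999LowDim, Thm. 0.1 (4)]
[cite: BirkenhakeLange2004, §13.3] -/
theorem divisorClasses_powPeriod_eq_hodgeClasses_of_orderOf_eq_five [HodgeTensorFacts.{0, 0}] {A : Matrix ι ι ℤ}
    (hA : A ∈ endRingInt P) (hord : orderOf A = 5) (hdim : finrank ℂ E = 2) (k p : ℕ) :
    divisorClasses (powPeriod P k) p = hodgeClasses (powPeriod P k) p := by
  have hζ := IsCyclotomicExtension.zeta_spec 5 ℚ (CyclotomicField 5 ℚ)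
  have hP : A.charpoly = cyclotomic 5 ℤ :=
    charpoly_eq_cyclotomic_of_orderOf_eq_of_finrank P Nat.prime_five.isPrimePow hord
      (by rw [hdim, Nat.totient_prime Nat.prime_five])
  obtain ⟨Φ, e, he, he', -⟩ := exists_iso_periodIso_one_of_orderOf_eq_five hζ hA hord hdim
  exact divisorClasses_powPeriod_eq_hodgeClasses_of_iso_of_prime hA hP (isSimple_periodIso_five Φ 1) e he he'
    Nat.prime_two (by rw [Nat.totient_prime Nat.prime_five]) k p

set_option backward.isDefEq.respectTransparency false in -- see above
/-- **`rank MT(X) = 3`** for a `2`-dimensional complex torus with an endomorphism of order `5` (a nondegenerate simple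
CM abelian surface). [cite: Yanai1985, §4 Theorem (p. 171)] [cite: MoonenZarhin1999LowDim, Thm. 0.1 (4)] -/
theorem mtRank_hodgeStructure_eq_three_of_orderOf_eq_five [HodgeTensorFacts.{0, 0}] {A : Matrix ι ι ℤ}
    (hA : A ∈ endRingInt P) (hord : orderOf A = 5) (hdim : finrank ℂ E = 2) : (hodgeStructure P 1).mtRank = 3 := by
  have hζ := IsCyclotomicExtension.zeta_spec 5 ℚ (CyclotomicField 5 ℚ)
  have hP : A.charpoly = cyclotomic 5 ℤ :=
    charpoly_eq_cyclotomic_of_orderOf_eq_of_finrank P Nat.prime_five.isPrimePow hord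
      (by rw [hdim, Nat.totient_prime Nat.prime_five])
  obtain ⟨Φ, e, he, he', -⟩ := exists_iso_periodIso_one_of_orderOf_eq_five hζ hA hord hdim
  exact mtRank_hodgeStructure_eq_of_iso_of_prime hA hP (isSimple_periodIso_five Φ 1) e he he' Nat.prime_two
    (by rw [Nat.totient_prime Nat.prime_five])

end Five

/-! ### §3 All powers of a one-dimensional complex torus with an endomorphism of order `3` -/

section Three

variable {ι : Type} [Fintype ι] [DecidableEq ι] {E : Type} [NormedAddCommGroup E] [NormedSpace ℂ E]
  {P : (ι → ℝ) ≃L[ℝ] E}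

set_option backward.isDefEq.respectTransparency false in -- see §2
/-- **THE HODGE CLASSES ON EVERY POWER OF A ONE-DIMENSIONAL COMPLEX TORUS WITH AN ENDOMORPHISM OF ORDER `3` ARE
GENERATED BY DIVISOR CLASSES** (powers of the CM elliptic curve with `j = 0`).
[cite: MoonenZarhin1999LowDim, Thm. 0.1 (4)] [cite: Gordon1999HodgeAVSurvey, Thm. 6.3 (2) and Remark] -/
theorem divisorClasses_powPeriod_eq_hodgeClasses_of_orderOf_eq_three [HodgeTensorFacts.{0, 0}] {A : Matrix ι ι ℤ}
    (hA : A ∈ endRingInt P) (hord : orderOf A = 3) (hdim : finrank ℂ E = 1) (k p : ℕ) :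
    divisorClasses (powPeriod P k) p = hodgeClasses (powPeriod P k) p := by
  have hζ := IsCyclotomicExtension.zeta_spec 3 ℚ (CyclotomicField 3 ℚ)
  have h2 : finrank ℚ (CyclotomicField 3 ℚ) = 2 := by
    rw [IsCyclotomicExtension.finrank (n := 3) (CyclotomicField 3 ℚ) (cyclotomic.irreducible_rat (by norm_num)),
      Nat.totient_prime Nat.prime_three]
  have hP : A.charpoly = cyclotomic 3 ℤ :=
    charpoly_eq_cyclotomic_of_orderOf_eq_of_finrank P Nat.prime_three.isPrimePow hord
      (by rw [hdim, Nat.totient_prime Nat.prime_three])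
  obtain ⟨Φ, e, he, he', -⟩ := exists_iso_periodIso_one_of_orderOf_eq_three hζ hA hord hdim
  exact divisorClasses_powPeriod_eq_hodgeClasses_of_iso_of_totient_le_six hA hP
    (isSimple_periodIso_of_finrank_eq_two h2 Φ 1) e he he' (by rw [Nat.totient_prime Nat.prime_three]; norm_num) k p

end Three

end ComplexTorus

end Literature.Geometry.Kaehler
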